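import Literature.AnabelianGeometry.SemiGraphs.TemperedAbsolutenessNonVacuity
import Literature.AnabelianGeometry.EtaleTheta.CyclotomeZHatEquiv
import HarnessLib

/-!
# [SemiAnbd] Thm. 6.12 interface `CyclotomeTransport`: UNCONDITIONAL genuine-shaped witnesses at the toy, and
# the Thm. 6.12 predicate `CuspidalCyclotomicRigidity` SATISFIED there

Mochizuki, *Semi-graphs of anabelioids*, Publ. RIMS **42** (2006) [SemiAnbd], Thm. 6.12 p. 78 (with
[Mzk8] Thm. 4.3 p. 36): «suppose that `α` induces isomorphisms `I_x ≅ I_y`; `μ_Ẑ(K̄) ≅ μ_Ẑ(L̄)` … Then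
these isomorphisms are compatible with the natural isomorphisms `μ_Ẑ(K̄) ≅ I_x`; `μ_Ẑ(L̄) ≅ I_y`», typed
(abc-iut-L3-t4, `TemperedAbsoluteness.lean`) as the interface record `CyclotomeTransport X Y` (the maps
`μ_Ẑ(K̄) → I_x ⊆ Π^tp`, with «image = `I_x`» at `K`-rational cusps, and `cycloOf α : μ_Ẑ(K̄) ≅ μ_Ẑ(L̄)`) and
the predicate `TemperedCurve.CuspidalCyclotomicRigidity X Y c`. [cite: MochizukiSemiAnbd2006, Thm 6.12 p.78]

PROOF-ONLY junction file (abc-iut NV-L3 lane, seat abc-iut-w5-d010; no `def`/`instance`/`structure`).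
It discharges the one hypothesis `e : Λ(ℚ̄_pˣ) ≃* Ẑ` of `CyclotomeTransport.nonempty_toyHyperbolic_of_mulEquiv`
(`TemperedAbsolutenessNonVacuity.lean`) by the classical isomorphism of `EtaleTheta/CyclotomeZHatEquiv.lean`
(`cyclotome.padicAlgCl_nonempty_mulEquiv_zHat`, `cyclotome.exists_generator_mulEquiv_zHat_of_isSepClosed`:
the inverse-limit cyclotome `Λ(ℚ̄_pˣ) = lim_n μ_n` has a generator and is `≃* Ẑ`), and goes one step further:

* `CyclotomeTransport.nonempty_toyHyperbolic` — the record is inhabited at abc-iut-L3's non-degenerate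
  `TemperedCurve.toyHyperbolic p`, the range clause holding NON-vacuously (`I_x = 1 × Ẑ × 1`);
* `CyclotomeTransport.exists_toyHyperbolic_oriented` — ORIENTED witness: a generator `ξ` of `μ_Ẑ(K̄)` (every
  `ξ_n` a primitive `n`-th root of unity in `ℚ̄_p`) goes to the topological generator `(1, η(1), 1)` of `I_x`;
* `CyclotomeTransport.exists_toyHyperbolic_cuspidalCyclotomicRigidity` — **the typed conclusion of
  Thm. 6.12 is SATISFIABLE jointly with genuine-shaped data**: with `cycloOf α` := «`α|_{I_x}` read in
  `μ_Ẑ(K̄)` through the orientation» (when `α(I_x) = I_x`; identity otherwise) — i.e. the cyclotome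
  isomorphism RECONSTRUCTED FROM `α` through the cuspidal inertia group — the predicate
  `CuspidalCyclotomicRigidity` HOLDS at the toy pair.  HONEST LIMIT: at the toy this compatibility is
  TAUTOLOGICAL (print's content is that the cyclotome isomorphism reconstructed by the [AbsAnab] route
  from `G_K ↷` agrees with the `I_x`-route; only the latter exists here), so this certifies consistency of
  the typed predicate with the typed data, nothing about print;
* `CyclotomeTransport.not_cuspidalCyclotomicRigidity_toyHyperbolic_of_cycloOf_refl` — conversely the field
  `cycloOf` is LOAD-BEARING: any datum with `cycloOf := id`, one map `μ_Ẑ(K̄) → Π^tp` on both sides, hitting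
  `(1, η(1), 1)`, VIOLATES the predicate at the toy, witnessed by the continuous automorphism `α = id × (inv × id)` of `Π^tp = G_{ℚ_p} × (Ẑ × P)`
  (it preserves `I_x` and inverts it; `η(1) ≠ η(1)⁻¹` in `Ẑ`).  So the typed Thm. 6.12 is not satisfiable
  by EVERY inhabitant of its data record — its conclusion genuinely constrains `cycloOf`.

Nothing here asserts Thm. 6.12; the toy is not a curve; the orientation is non-canonical (print's
`Ẑ^×`-indeterminacy); nothing bears on [IUTchIII] Cor. 3.12.
-/

noncomputable section

namespace Literature.AnabelianGeometry.SemiGraphs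

open Literature.AnabelianGeometry.EtaleTheta (cyclotome)
open Literature.AnabelianGeometry.EtaleTheta

variable (p : ℕ) [Fact p.Prime]

namespace CyclotomeTransport

/-! ### Unconditional inhabitants -/

/-- **`CyclotomeTransport` is inhabited at the non-degenerate toy, unconditionally**: `μ_Ẑ(K̄) = Λ(ℚ̄_pˣ)`
maps ONTO the inertia group `I_x = 1 × Ẑ × 1` of the `K`-rational cusp through a group isomorphism
`Λ(ℚ̄_pˣ) ≃* Ẑ` (classical, `cyclotome.padicAlgCl_nonempty_mulEquiv_zHat`). [cite: MochizukiSemiAnbd2006, Thm 6.12 p.78] -/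
theorem nonempty_toyHyperbolic :
    Nonempty (CyclotomeTransport (TemperedCurve.toyHyperbolic p) (TemperedCurve.toyHyperbolic p)) :=
  nonempty_toyHyperbolic_of_nonempty_mulEquiv p (cyclotome.padicAlgCl_nonempty_mulEquiv_zHat p)

/-- **Oriented witness**: there are a GENERATOR `ξ` of the cyclotome `Λ(ℚ̄_pˣ)` (every component `ξ_n` a
primitive `n`-th root of unity) and a `CyclotomeTransport` datum at the toy pair sending `ξ` to the
topological generator `(1, η(1), 1)` of `I_x = 1 × Ẑ × 1` at every cusp, with `cycloOf := id`.
[cite: MochizukiSemiAnbd2006, Thm 6.12 p.78] -/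
theorem exists_toyHyperbolic_oriented :
    ∃ (ξ : cyclotome (AlgebraicClosure ℚ_[p])ˣ)
      (T : CyclotomeTransport (TemperedCurve.toyHyperbolic p) (TemperedCurve.toyHyperbolic p)),
      (∀ n : ℕ+, IsPrimitiveRoot ((ξ : ℕ+ → (AlgebraicClosure ℚ_[p])ˣ) n) (n : ℕ)) ∧
      (∀ x, T.cycloToInertiaX x ξ = ((1 : GQp p), (ZHatLevel.eta 1, (1 : Iw p)))) ∧
      (∀ y, T.cycloToInertiaY y ξ = ((1 : GQp p), (ZHatLevel.eta 1, (1 : Iw p)))) ∧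
      (∀ x y ζ, T.cycloToInertiaX x ζ = T.cycloToInertiaY y ζ) ∧
      ∀ α, T.cycloOf α = MulEquiv.refl _ := by
  haveI : CharZero (AlgebraicClosure ℚ_[p]) :=
    charZero_of_injective_algebraMap (algebraMap ℚ_[p] (AlgebraicClosure ℚ_[p])).injective
  obtain ⟨ξ, e, hξ, he, -⟩ :=
    cyclotome.exists_generator_mulEquiv_zHat_of_isSepClosed (AlgebraicClosure ℚ_[p])
  refine ⟨ξ,
    { cycloToInertiaX := fun _ =>
        ((MonoidHom.inr (GQp p) (ZHat × Iw p)).comp (MonoidHom.inl ZHat (Iw p))).comp e.toMonoidHom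
      cycloToInertiaY := fun _ =>
        ((MonoidHom.inr (GQp p) (ZHat × Iw p)).comp (MonoidHom.inl ZHat (Iw p))).comp e.toMonoidHom
      range_cycloToInertiaX := fun x _ _ => range_toyCycloToInertia p e x
      range_cycloToInertiaY := fun y _ _ => range_toyCycloToInertia p e y
      cycloOf := fun _ => MulEquiv.refl _ }, hξ, fun x => ?_, fun y => ?_, fun _ _ _ => rfl, fun α => rfl⟩
  · change ((1 : GQp p), (e ξ, (1 : Iw p))) = _
    rw [he]
  · change ((1 : GQp p), (e ξ, (1 : Iw p))) = _
    rw [he]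

/-! ### The automorphism of `Ẑ` induced on `I_x` by an `α` preserving `I_x` -/

/-- An element of the toy inertia group `I_x = 1 × Ẑ × 1` is determined by its `Ẑ`-coordinate.
[cite: MochizukiSemiAnbd2006, §6 p.71] -/
theorem eq_of_mem_toyInertia {g : ToyPi p}
    (hg : g ∈ toyDecomp p ⊓ (ContinuousMonoidHom.fst (GQp p) (ZHat × Iw p)).toMonoidHom.ker) :
    g = ((1 : GQp p), (g.2.1, (1 : Iw p))) := by
  have h := (TemperedCurve.mem_toyHyperbolic_inertia_iff p () g).1 hg
  exact Prod.ext h.1 (Prod.ext rfl h.2)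

/-- `(1, z, 1) ∈ I_x`. [cite: MochizukiSemiAnbd2006, §6 p.71] -/
theorem mk_mem_toyInertia (z : ZHat) :
    ((1 : GQp p), (z, (1 : Iw p))) ∈
      toyDecomp p ⊓ (ContinuousMonoidHom.fst (GQp p) (ZHat × Iw p)).toMonoidHom.ker :=
  (TemperedCurve.mem_toyHyperbolic_inertia_iff p () _).2 ⟨rfl, rfl⟩

/-- **The automorphism `α|_{I_x}` of `Ẑ`.**  For a continuous automorphism `α` of the toy `Π^tp` with
`α(I_x) = I_x` there is a group automorphism `u` of `Ẑ` with `α (1, z, 1) = (1, u z, 1)` for all `z`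
(the isomorphism «`I_x ≅ I_y` induced by `α`» of Thm. 6.12, read in `Ẑ`). [cite: MochizukiSemiAnbd2006, Thm 6.12 p.78] -/
theorem exists_mulEquiv_of_map_inertia_eq (α : ToyPi p ≃ₜ* ToyPi p)
    (hα : (toyDecomp p ⊓ (ContinuousMonoidHom.fst (GQp p) (ZHat × Iw p)).toMonoidHom.ker).map
        α.toMulEquiv.toMonoidHom =
      toyDecomp p ⊓ (ContinuousMonoidHom.fst (GQp p) (ZHat × Iw p)).toMonoidHom.ker) :
    ∃ u : ZHat ≃* ZHat, ∀ z : ZHat, α ((1 : GQp p), (z, (1 : Iw p))) = ((1 : GQp p), (u z, (1 : Iw p))) := by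
  -- `α` and `α⁻¹` map `I_x` into `I_x`
  have hfwd : ∀ z : ZHat, α ((1 : GQp p), (z, (1 : Iw p))) ∈
      toyDecomp p ⊓ (ContinuousMonoidHom.fst (GQp p) (ZHat × Iw p)).toMonoidHom.ker := by
    intro z
    rw [← hα]
    exact ⟨_, mk_mem_toyInertia p z, rfl⟩
  have hbwd : ∀ z : ZHat, α.symm ((1 : GQp p), (z, (1 : Iw p))) ∈
      toyDecomp p ⊓ (ContinuousMonoidHom.fst (GQp p) (ZHat × Iw p)).toMonoidHom.ker := by
    intro z
    have hz : ((1 : GQp p), (z, (1 : Iw p))) ∈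
        (toyDecomp p ⊓ (ContinuousMonoidHom.fst (GQp p) (ZHat × Iw p)).toMonoidHom.ker).map
          α.toMulEquiv.toMonoidHom := by
      rw [hα]; exact mk_mem_toyInertia p z
    obtain ⟨g, hg, hgz⟩ := hz
    have : α.symm ((1 : GQp p), (z, (1 : Iw p))) = g := by
      rw [← hgz]
      exact α.symm_apply_apply g
    rw [this]
    exact hg
  refine ⟨{ toFun := fun z => (α ((1 : GQp p), (z, (1 : Iw p)))).2.1
            invFun := fun z => (α.symm ((1 : GQp p), (z, (1 : Iw p)))).2.1
            left_inv := fun z => ?_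
            right_inv := fun z => ?_
            map_mul' := fun z w => ?_ }, fun z => ?_⟩
  · -- `α⁻¹ (α (1,z,1)) = (1,z,1)`, using that `α (1,z,1) ∈ I_x` has the normal form `(1, ·, 1)`
    have h1 := eq_of_mem_toyInertia p (hfwd z)
    have h2 : α.symm (α ((1 : GQp p), (z, (1 : Iw p)))) = ((1 : GQp p), (z, (1 : Iw p))) :=
      α.symm_apply_apply _
    rw [h1] at h2
    exact (congrArg (fun g : ToyPi p => g.2.1) h2 : _)
  · have h1 := eq_of_mem_toyInertia p (hbwd z)
    have h2 : α (α.symm ((1 : GQp p), (z, (1 : Iw p)))) = ((1 : GQp p), (z, (1 : Iw p))) :=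
      α.apply_symm_apply _
    rw [h1] at h2
    exact (congrArg (fun g : ToyPi p => g.2.1) h2 : _)
  · have hmul : (((1 : GQp p), (z * w, (1 : Iw p))) : ToyPi p) =
        ((1 : GQp p), (z, (1 : Iw p))) * ((1 : GQp p), (w, (1 : Iw p))) := by
      refine Prod.ext (by simp) (Prod.ext (by simp) (by simp))
    rw [hmul, map_mul]
    rfl
  · exact eq_of_mem_toyInertia p (hfwd z)

/-! ### Thm. 6.12's predicate HOLDS at the toy for the reconstructed `cycloOf` -/

/-- **`CuspidalCyclotomicRigidity` is satisfiable jointly with genuine-shaped data.**  At the toy pair there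
is a `CyclotomeTransport` datum — `μ_Ẑ(K̄) → Π^tp` an orientation onto `I_x` as above, and `cycloOf α :=`
the automorphism of `μ_Ẑ(K̄)` obtained by transporting `α|_{I_x}` along that orientation (when
`α(I_x) = I_x`; the identity otherwise) — for which the typed conclusion of [SemiAnbd] Thm. 6.12 HOLDS:
`α ∘ (μ_Ẑ(K̄) → I_x) = (μ_Ẑ(L̄) → I_y) ∘ cycloOf α` for every `α` inducing `I_x ≅ I_y`.  HONEST: tautological
at the toy (the cyclotome isomorphism is reconstructed through `I_x` itself, not by print's [AbsAnab]
route); consistency evidence for the typing only. [cite: MochizukiSemiAnbd2006, Thm 6.12 p.78] -/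
theorem exists_toyHyperbolic_cuspidalCyclotomicRigidity :
    ∃ T : CyclotomeTransport (TemperedCurve.toyHyperbolic p) (TemperedCurve.toyHyperbolic p),
      (TemperedCurve.toyHyperbolic p).CuspidalCyclotomicRigidity (TemperedCurve.toyHyperbolic p) T := by
  classical
  obtain ⟨e⟩ := cyclotome.padicAlgCl_nonempty_mulEquiv_zHat p
  -- the reconstructed cyclotome automorphism attached to `α` (identity when `α` does not preserve `I_x`)
  obtain ⟨cyc, hcyc⟩ : ∃ cyc : (ToyPi p ≃ₜ* ToyPi p) →
      (cyclotome (AlgebraicClosure ℚ_[p])ˣ ≃* cyclotome (AlgebraicClosure ℚ_[p])ˣ),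
      ∀ (α : ToyPi p ≃ₜ* ToyPi p)
        (hα : (toyDecomp p ⊓ (ContinuousMonoidHom.fst (GQp p) (ZHat × Iw p)).toMonoidHom.ker).map
            α.toMulEquiv.toMonoidHom =
          toyDecomp p ⊓ (ContinuousMonoidHom.fst (GQp p) (ZHat × Iw p)).toMonoidHom.ker),
        cyc α = e.trans ((Classical.choose (exists_mulEquiv_of_map_inertia_eq p α hα)).trans e.symm) :=
    ⟨fun α =>
      if hα : (toyDecomp p ⊓ (ContinuousMonoidHom.fst (GQp p) (ZHat × Iw p)).toMonoidHom.ker).map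
            α.toMulEquiv.toMonoidHom =
          toyDecomp p ⊓ (ContinuousMonoidHom.fst (GQp p) (ZHat × Iw p)).toMonoidHom.ker then
        e.trans ((Classical.choose (exists_mulEquiv_of_map_inertia_eq p α hα)).trans e.symm)
      else MulEquiv.refl _,
     fun α hα => dif_pos hα⟩
  refine ⟨{ cycloToInertiaX := fun _ =>
              ((MonoidHom.inr (GQp p) (ZHat × Iw p)).comp (MonoidHom.inl ZHat (Iw p))).comp e.toMonoidHom
            cycloToInertiaY := fun _ =>
              ((MonoidHom.inr (GQp p) (ZHat × Iw p)).comp (MonoidHom.inl ZHat (Iw p))).comp e.toMonoidHom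
            range_cycloToInertiaX := fun x _ _ => range_toyCycloToInertia p e x
            range_cycloToInertiaY := fun y _ _ => range_toyCycloToInertia p e y
            cycloOf := cyc }, ?_⟩
  intro α x y _ _ _ _ hα ζ
  -- the hypothesis `α(I_x) = I_y` is literally `I.map α = I` for the toy inertia group `I`
  have hα' : (toyDecomp p ⊓ (ContinuousMonoidHom.fst (GQp p) (ZHat × Iw p)).toMonoidHom.ker).map
        α.toMulEquiv.toMonoidHom =
      toyDecomp p ⊓ (ContinuousMonoidHom.fst (GQp p) (ZHat × Iw p)).toMonoidHom.ker := hα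
  have hspec := Classical.choose_spec (exists_mulEquiv_of_map_inertia_eq p α hα')
  change α ((1 : GQp p), (e ζ, (1 : Iw p))) = ((1 : GQp p), (e (cyc α ζ), (1 : Iw p)))
  refine (hspec (e ζ)).trans ?_
  rw [hcyc α hα']
  simp

/-! ### The field `cycloOf` is load-bearing: the naive datum violates Thm. 6.12 at the toy -/

/-- `η(1) ≠ η(1)⁻¹` in `Ẑ` (its level-`3` character is `1 ≠ −1 (mod 3)`). [cite: RibesZalesskii2010, Thm 2.7.1] -/
theorem eta_one_ne_inv : ZHatLevel.eta 1 ≠ (ZHatLevel.eta 1)⁻¹ := by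
  intro h
  have h3 := congrArg (fun z => Multiplicative.toAdd (ZHatLevel.level 3 z)) h
  simp only [map_inv, toAdd_inv, ZHatLevel.level_eta, toAdd_ofAdd, Int.cast_one] at h3
  revert h3
  decide

/-- **With `cycloOf := id`, Thm. 6.12's predicate FAILS at the toy**: for ANY datum whose cyclotome
isomorphisms are all the identity and whose map `μ_Ẑ(K̄) → Π^tp` hits `(1, η(1), 1)`, the continuous
automorphism `α := id_{G_{ℚ_p}} × (inv_Ẑ × id_P)` of `Π^tp = G_{ℚ_p} × (Ẑ × P)` (`Ẑ` is commutative) maps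
`I_x` onto itself but inverts it, so `α ∘ (μ_Ẑ → I_x) ≠ (μ_Ẑ → I_y) ∘ id`.  Hence the typed conclusion of
Thm. 6.12 genuinely constrains the `cycloOf` field (it is not satisfied by every inhabitant of the record).
[cite: MochizukiSemiAnbd2006, Thm 6.12 p.78] -/
theorem not_cuspidalCyclotomicRigidity_toyHyperbolic_of_cycloOf_refl
    (T : CyclotomeTransport (TemperedCurve.toyHyperbolic p) (TemperedCurve.toyHyperbolic p))
    (hrefl : ∀ α, T.cycloOf α = MulEquiv.refl _)
    (hXY : ∀ x y ζ, T.cycloToInertiaX x ζ = T.cycloToInertiaY y ζ)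
    (hhit : ∀ x, ∃ ζ, T.cycloToInertiaX x ζ = ((1 : GQp p), (ZHatLevel.eta 1, (1 : Iw p)))) :
    ¬ (TemperedCurve.toyHyperbolic p).CuspidalCyclotomicRigidity (TemperedCurve.toyHyperbolic p) T := by
  haveI : IsGalois ℚ_[p] (AlgebraicClosure ℚ_[p]) := {}
  haveI : T2Space (GQp p) := krullTopology_t2
  intro hrig
  -- `Ẑ` is commutative (its level characters land in the commutative `ℤ/nℤ` and separate points)
  have hcomm : ∀ z w : ZHat, z * w = w * z := fun z w =>
    ZHatLevel.ext_of_level fun n => by rw [map_mul, map_mul, mul_comm]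
  -- `α := id × (inv × id)`, a continuous automorphism since `Ẑ` is commutative
  let α : ToyPi p ≃ₜ* ToyPi p :=
    { toFun := fun g => (g.1, ((g.2.1)⁻¹, g.2.2))
      invFun := fun g => (g.1, ((g.2.1)⁻¹, g.2.2))
      left_inv := fun g => by simp
      right_inv := fun g => by simp
      map_mul' := fun g h => by
        refine Prod.ext rfl (Prod.ext ?_ rfl)
        change (g.2.1 * h.2.1)⁻¹ = (g.2.1)⁻¹ * (h.2.1)⁻¹
        rw [mul_inv_rev]
        exact hcomm _ _
      continuous_toFun := by fun_prop
      continuous_invFun := by fun_prop }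
  have hαapp : ∀ (g : GQp p) (z : ZHat) (w : Iw p), α (g, (z, w)) = (g, (z⁻¹, w)) := fun _ _ _ => rfl
  -- `α (I_x) = I_x`
  have hαI : (toyDecomp p ⊓ (ContinuousMonoidHom.fst (GQp p) (ZHat × Iw p)).toMonoidHom.ker).map
        α.toMulEquiv.toMonoidHom =
      toyDecomp p ⊓ (ContinuousMonoidHom.fst (GQp p) (ZHat × Iw p)).toMonoidHom.ker := by
    ext g
    constructor
    · rintro ⟨g', hg', rfl⟩
      rw [eq_of_mem_toyInertia p hg']
      exact mk_mem_toyInertia p _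
    · intro hg
      refine ⟨((1 : GQp p), ((g.2.1)⁻¹, (1 : Iw p))), mk_mem_toyInertia p _, ?_⟩
      rw [eq_of_mem_toyInertia p hg]
      change α ((1 : GQp p), ((g.2.1)⁻¹, (1 : Iw p))) = _
      rw [hαapp, inv_inv]
  obtain ⟨ζ, hζ⟩ := hhit ()
  have h := hrig α () () trivial (TemperedCurve.toyHyperbolic_isRationalPt p ()) trivial
    (TemperedCurve.toyHyperbolic_isRationalPt p ()) hαI ζ
  rw [hrefl, MulEquiv.refl_apply, ← hXY () (), hζ] at h
  change α ((1 : GQp p), (ZHatLevel.eta 1, (1 : Iw p))) = _ at h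
  rw [hαapp] at h
  exact eta_one_ne_inv ((congrArg (fun g : ToyPi p => g.2.1) h).symm)

/-- In particular the ORIENTED identity-`cycloOf` witnesses (`exists_toyHyperbolic_oriented`, and the shape of
p424072's `nonempty_toyHyperbolic_of_mulEquiv`) do NOT satisfy Thm. 6.12's predicate, while the reconstructed
datum of `exists_toyHyperbolic_cuspidalCyclotomicRigidity` does: at the toy BOTH the predicate and its
negation are realised by inhabitants of the data record. [cite: MochizukiSemiAnbd2006, Thm 6.12 p.78] -/
theorem exists_toyHyperbolic_not_cuspidalCyclotomicRigidity :
    ∃ T : CyclotomeTransport (TemperedCurve.toyHyperbolic p) (TemperedCurve.toyHyperbolic p),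
      ¬ (TemperedCurve.toyHyperbolic p).CuspidalCyclotomicRigidity (TemperedCurve.toyHyperbolic p) T := by
  obtain ⟨ξ, T, -, hX, -, hXY, hrefl⟩ := exists_toyHyperbolic_oriented p
  exact ⟨T, not_cuspidalCyclotomicRigidity_toyHyperbolic_of_cycloOf_refl p T hrefl hXY
    fun x => ⟨ξ, hX x⟩⟩

end CyclotomeTransport

end Literature.AnabelianGeometry.SemiGraphs

end
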